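import Summits.BirchSwinnertonDyer.BirchSwinnertonDyer.Theorems.KimAtThreeFineKatoKPortCuspChart
import HarnessLib

/-!
# K-PORT glue: the UNIT-TRACE POINT — `∃ P ∈ E₀(K), N(P) = ∑_σ σP ∉ E₁(K)` for an unramified finite
# Galois-type `K ⊇ ℚ_p` and a cuspidal `𝒪_K`-model (gen 0's hypothesis `hres`, given cusp data)
# (cell `bsd-addord`, seat w2-kport gen 2; `--supports stmt-BirchSwinnertonDyer-19560`, helper)

HONEST FRAMING. Route W2 (`route-BirchSwinnertonDyer-KimAtThreeKolyvagin`), crux 19560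
`KatoKuriharaPortThreeShared`, residual ⟨C1⟩ clause (C1.c) = SAT₀'s E-side. Gen 0's CONSUMER THEOREM
`KPort.consumer_of_exists_norm_not_mem_kernel` (`…KPortConsumer`) is stated modulo
`hres : ∃ P ∈ E₀(K), N(P) ∉ E₁(K)`. This file PROVES `hres` for any `M/ℤ_p` whose reduction over
`k = 𝒪_K/𝔪_K` is a cusp with `ℤ_p`-rational cusp data (hypothesis `hV : Ṽ = singularModel x̄₀ ȳ₀ ᾱ ᾱ`,
discharged at `p = 3` in `…KPortCuspThree`; ANY prime `p`) and any finite-dimensional complete ultrametric `ℚ_p`-field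
`K` with `𝔪_K = p𝒪_K` (`hK`), by assembling this gen's three inputs:
(`…KPortCuspChart`) the cusp chart `r : E₀(K) ↠ k⁺` with kernel `E₁(K)`, `Gal`-equivariant;
(`…KPortUnitTrace`) an `a ∈ 𝒪_K` with `‖∑_σ σa‖ = 1`; and the computation `r(N(P)~) = ∑_σ (σa)‾ = (∑_σ σa)‾`
for `P` with `r(P̃) = ā` (`exists_mem_sum_galois_mem_kernel_iff`). COORDINATION (planner g20 COORD/DEDUP
2026-08-27T04:59Z): the `p = 3` discharge of `hres` and the hypothesis-free consumer theorem are seat w2-acc4's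
`…KPortResidueNorm` (landed first; rigidity argument for `p` odd); this file is the `p`-uniform engine over
this seat's (T0)–(T3) tools (`…KPortResidueField/Inertia/UnitTrace/CuspChart`), kept as the tool of record
for the `K := L_w` junction (T5). TOOL theorems only (no definition, no named fact, no `sorry`); closes
nothing by itself; nothing booked.

## What is proved

* `reducePoint_sum` (any valuation ring: reduction is additive on finite sums of `E₀`-points),
  `reducePoint_sum_galois` (`(N P)~ = ∑ (σP)~`), `cuspChart_reducePoint_sum_galois` (`r(N(P)~) = (∑ σa)‾`).
* `exists_mem_sum_galois_mem_kernel_iff` — for every `a ∈ 𝒪_K` some `P ∈ E₀(K)` has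
  `N(P) ∈ E₁(K) ↔ ‖∑_σ σ a‖ < 1`.
* **`exists_sum_galois_not_mem_kernel_of_cuspModel`** — `hres`: `∃ P ∈ E₀(K), N(P) ∉ E₁(K)` (given `hK`, `hV`;
  ANY `p`). At `p = 3` the cusp data are supplied by `…KPortCuspThree.map_residue_eq_singularModel_of_three`;
  the resulting `p = 3` statement coincides with seat w2-acc4's `KPort.exists_sum_galois_not_mem_kernel`
  (`…KPortResidueNorm`, landed first, different proof) and is therefore NOT restated here.

References: J. H. Silverman, *The Arithmetic of Elliptic Curves*, 2nd ed. (2009), III.2.5, VII.2.1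
[SilvermanAEC2009]; J.-P. Serre, *Local Fields* (1979), Ch. I §7, III §5 [SerreLocalFields1979];
kim3 brief HOME/kim3/KIM3-KPORT-BRIEF-g12.md §3.
-/

noncomputable section

-- the cell's Theorems namespace `Summit.BirchSwinnertonDyer.BirchSwinnertonDyer.…` repeats the summit name by design (D-0017)
set_option linter.dupNamespace false

open scoped Classical NNReal

namespace Summit.BirchSwinnertonDyer.BirchSwinnertonDyer.Theorems.KPort

open Summit.BirchSwinnertonDyer.Rank1Residual.Additive.BallEval
open Literature.NumberTheory.GaloisRepresentations.LubinTate (unitBall mem_unitBall_iff)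
open Literature.NumberTheory.EllipticCurves Literature.NumberTheory.EllipticCurves.FormalGroupChart
open WeierstrassCurve

variable {p : ℕ} [hp : Fact p.Prime] {K : Type*} [NontriviallyNormedField K] [NormedAlgebra ℚ_[p] K]
  [IsUltrametricDist K] [FiniteDimensional ℚ_[p] K] {M : WeierstrassCurve ℤ_[p]}

/-- **Reduction is additive on finite sums of `E₀`-points** (any valuation ring; the tree's
`reducePoint_add` iterated). [cite: SilvermanAEC2009, VII.2 Prop. 2.1] -/
theorem reducePoint_sum {F : Type*} [Field F] {Γ₀ : Type*} [LinearOrderedCommGroupWithZero Γ₀]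
    {v : Valuation F Γ₀} {R : Type*} [CommRing R] [IsLocalRing R] [Algebra R F] (W : WeierstrassCurve R)
    (hv : v.Integers R) {ι : Type*} (s : Finset ι) (f : ι → (W.baseChange F).toAffine.Point)
    (hf : ∀ i ∈ s, W.HasNonsingularReduction (f i)) :
    W.reducePoint (∑ i ∈ s, f i) = ∑ i ∈ s, W.reducePoint (f i) := by
  induction s using Finset.induction_on with
  | empty => rw [Finset.sum_empty, Finset.sum_empty]; exact WeierstrassCurve.reducePoint_zero
  | insert a s ha ih =>
    have hs : ∀ i ∈ s, W.HasNonsingularReduction (f i) := fun i hi => hf i (Finset.mem_insert_of_mem hi)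
    have hsum : W.HasNonsingularReduction (∑ i ∈ s, f i) := by
      have hmem : (∑ i ∈ s, f i) ∈ W.nonsingularReductionSubgroup hv :=
        AddSubgroup.sum_mem _ fun i hi => (mem_nonsingularReductionSubgroup_iff hv).mpr (hs i hi)
      exact (mem_nonsingularReductionSubgroup_iff hv).mp hmem
    rw [Finset.sum_insert ha, Finset.sum_insert ha, reducePoint_add hv (hf a (Finset.mem_insert_self a s)) hsum,
      ih hs]

/-- **Reduction of the norm**: for `P ∈ E₀(K)`, `(N(P))~ = ∑_σ (σP)~` (`E₀(K)` is `Gal`-stable).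
[cite: SilvermanAEC2009, VII.2 Prop. 2.1] -/
theorem reducePoint_sum_galois {P : (curveK p K M).toAffine.Point}
    (hP : P ∈ (M.map (coeffHom p K)).nonsingularReductionSubgroup
      (Valuation.integer.integers (NormedField.valuation (K := K)))) :
    (M.map (coeffHom p K)).reducePoint
        (∑ σ : K ≃ₐ[ℚ_[p]] K, Affine.Point.map (W' := (M.map PadicInt.Coe.ringHom).toAffine)
          (σ : K →ₐ[ℚ_[p]] K) P) =
      ∑ σ : K ≃ₐ[ℚ_[p]] K, (M.map (coeffHom p K)).reducePoint
        (Affine.Point.map (W' := (M.map PadicInt.Coe.ringHom).toAffine) (σ : K →ₐ[ℚ_[p]] K) P) := by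
  haveI : Algebra.IsAlgebraic ℚ_[p] K := Algebra.IsAlgebraic.of_finite ℚ_[p] K
  have hv := Valuation.integer.integers (NormedField.valuation (K := K))
  exact reducePoint_sum (M.map (coeffHom p K)) hv Finset.univ _ fun σ _ =>
    (mem_nonsingularReductionSubgroup_iff hv).mp ((galois_mem_nonsingularReductionSubgroup_iff σ P).mpr hP)

variable {x₀ y₀ α : ℤ_[p]}
  (hV : (M.map (coeffHom p K)).map (IsLocalRing.residue (unitBall K)) =
    singularModel (IsLocalRing.residue (unitBall K) (coeffHom p K x₀))
      (IsLocalRing.residue (unitBall K) (coeffHom p K y₀))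
      (IsLocalRing.residue (unitBall K) (coeffHom p K α)) (IsLocalRing.residue (unitBall K) (coeffHom p K α)))
include hV

/-- **`r(N(P)~) = (∑_σ σa)‾`** for a point `P ∈ E₀(K)` with chart value `r(P̃) = ā`.
[cite: SilvermanAEC2009, VII.2 Prop. 2.1 and III.2.5(b)] -/
theorem cuspChart_reducePoint_sum_galois {P : (curveK p K M).toAffine.Point}
    (hP : P ∈ (M.map (coeffHom p K)).nonsingularReductionSubgroup
      (Valuation.integer.integers (NormedField.valuation (K := K))))
    {a : K} (ha : ‖a‖ ≤ 1)
    (hPa : singularModel.cuspHom _ _ _ (Affine.Point.congrEquiv hV ((M.map (coeffHom p K)).reducePoint P)) =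
      IsLocalRing.residue (unitBall K) ⟨a, (mem_unitBall_iff K).mpr ha⟩) :
    singularModel.cuspHom _ _ _ (Affine.Point.congrEquiv hV ((M.map (coeffHom p K)).reducePoint
        (∑ σ : K ≃ₐ[ℚ_[p]] K, Affine.Point.map (W' := (M.map PadicInt.Coe.ringHom).toAffine)
          (σ : K →ₐ[ℚ_[p]] K) P))) =
      IsLocalRing.residue (unitBall K) (∑ σ : K ≃ₐ[ℚ_[p]] K,
        (⟨σ a, (mem_unitBall_iff K).mpr (norm_galois_le_one
          (haveI : Algebra.IsAlgebraic ℚ_[p] K := Algebra.IsAlgebraic.of_finite ℚ_[p] K; σ) ha)⟩ : unitBall K)) := by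
  haveI : Algebra.IsAlgebraic ℚ_[p] K := Algebra.IsAlgebraic.of_finite ℚ_[p] K
  rw [reducePoint_sum_galois hP, map_sum, map_sum, map_sum]
  exact Finset.sum_congr rfl fun σ _ => cuspChart_reducePoint_galois hV σ hP ha hPa

/-- **`r(N(P)~) = (Tr a)‾`, membership form.** For every `a ∈ 𝒪_K` there is `P ∈ E₀(K)` (with
`r(P̃) = ā`) such that `N(P) = ∑_σ σP ∈ E₁(K) ↔ ‖∑_σ σ a‖ < 1`. [cite: SilvermanAEC2009, VII.2 Prop. 2.1 and III.2.5(b)] -/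
theorem exists_mem_sum_galois_mem_kernel_iff
    [hint : (curveK p K M).IsIntegral (NormedField.valuation (K := K)).integer] {a : K} (ha : ‖a‖ ≤ 1) :
    ∃ P ∈ (M.map (coeffHom p K)).nonsingularReductionSubgroup
        (Valuation.integer.integers (NormedField.valuation (K := K))),
      ((∑ σ : K ≃ₐ[ℚ_[p]] K, Affine.Point.map (W' := (M.map PadicInt.Coe.ringHom).toAffine)
          (σ : K →ₐ[ℚ_[p]] K) P) ∈
        kernel (NormedField.valuation (K := K)) (curveK p K M) ↔
      ‖∑ σ : K ≃ₐ[ℚ_[p]] K, σ a‖ < 1) := by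
  haveI : Algebra.IsAlgebraic ℚ_[p] K := Algebra.IsAlgebraic.of_finite ℚ_[p] K
  obtain ⟨P, hP, hPa⟩ := exists_mem_nonsingularReductionSubgroup_cuspChart_eq hV
    (IsLocalRing.residue (unitBall K) ⟨a, (mem_unitBall_iff K).mpr ha⟩)
  refine ⟨P, hP, ?_⟩
  have hNP := sum_galois_mem_nonsingularReductionSubgroup hP
  have hchart := cuspChart_reducePoint_sum_galois hV hP ha hPa
  have hnorm : IsLocalRing.residue (unitBall K) (∑ σ : K ≃ₐ[ℚ_[p]] K,
      (⟨σ a, (mem_unitBall_iff K).mpr (norm_galois_le_one σ ha)⟩ : unitBall K)) = 0 ↔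
      ‖∑ σ : K ≃ₐ[ℚ_[p]] K, σ a‖ < 1 := by
    rw [residue_eq_zero_iff_norm_lt_one]; push_cast; exact Iff.rfl
  refine (mem_kernel_iff_reducesToZero_curveK _).trans ?_
  refine (cuspChart_reducePoint_eq_zero_iff hV hNP).symm.trans ⟨fun h0 => ?_, fun hlt => ?_⟩
  · exact hnorm.mp (hchart.symm.trans h0)
  · exact hchart.trans (hnorm.mpr hlt)

/-- **THE UNIT-TRACE POINT (`hres`).** Let `K ⊇ ℚ_p` be finite-dimensional, complete ultrametric, with
`𝔪_K = p𝒪_K` (`hK`), and let `M/ℤ_p` have cuspidal reduction with `ℤ_p`-rational cusp data (`hV`).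
Then some `P ∈ E₀(K)` has `N(P) = ∑_{σ ∈ Aut_{ℚ_p} K} σP ∉ E₁(K)`: take `a ∈ 𝒪_K` of unit trace
(`…KPortUnitTrace`) and `P` with cusp-chart value `ā`. [cite: SilvermanAEC2009, VII.2 Prop. 2.1 and III.2.5(b)] -/
theorem exists_sum_galois_not_mem_kernel_of_cuspModel
    [hint : (curveK p K M).IsIntegral (NormedField.valuation (K := K)).integer]
    (hK : ∀ x : K, ‖x‖ < 1 → ‖x‖ ≤ ‖(p : K)‖) :
    ∃ P ∈ (M.map (coeffHom p K)).nonsingularReductionSubgroup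
        (Valuation.integer.integers (NormedField.valuation (K := K))),
      (∑ σ : K ≃ₐ[ℚ_[p]] K, Affine.Point.map (W' := (M.map PadicInt.Coe.ringHom).toAffine)
          (σ : K →ₐ[ℚ_[p]] K) P) ∉
        kernel (NormedField.valuation (K := K)) (curveK p K M) := by
  obtain ⟨a, ha, hsum⟩ := exists_norm_sum_galois_eq_one (p := p) (K := K) hK
  obtain ⟨P, hP, hiff⟩ := exists_mem_sum_galois_mem_kernel_iff hV ha
  exact ⟨P, hP, fun h => (hiff.mp h).ne hsum⟩

end Summit.BirchSwinnertonDyer.BirchSwinnertonDyer.Theorems.KPort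

end
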